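import Literature.Analysis.ValidatedNumerics.CodeListKrawczykDataCertificate
import Literature.Analysis.ValidatedNumerics.SparsePolynomialEnclosure
import HarnessLib

/-!
# Krawczyk certificate for VARIABLE-SPARSE polynomial systems: rows as monomial tables (format (C))

Topic `Literature/Analysis/ValidatedNumerics`.  Sequel of `CodeListKrawczykDataCertificate.lean` (split certificate:
per-row obligations + `coreCheck`) for the case where every component `fᵢ` is a POLYNOMIAL given as a table of terms
`(c, [(v₁,e₁),…,(v_r,e_r)])` standing for `c · x_{v₁}^{e₁} ⋯ x_{v_r}^{e_r}` (coefficient `c = p/q` as `(p, q) : ℤ × ℕ`,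
variables by index, only the variables that OCCUR listed).  The per-row obligation of the parent file runs the derived
code list `∂ₖfᵢ` over the box for EVERY `k < n` — `n` traversals of the row; here the value and all partials of each
monomial are enclosed directly from the table (Moore's natural extension "in monomial form", powers and products of
intervals, §3.3 Cor. 3.1; term-by-term differentiation, §4.3 (4.21)), so the cost of a row is proportional to the number
of (term, occurring variable) pairs, not to `n ×` terms.

* `SparsePoly.monoE / ofTerms` — the code list (`FExpr`) denoted by a table (so the SEMANTICS, the natural domain and
  `fderiv = eval ∘ pderiv` are those of the parent files); `monoVal / rowVal / dmonoVal / drowVal` — their values and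
  `k`-th partials in closed form (`eval_ofTerms`, `eval_pderiv_ofTerms`);
* `SparsePoly.powI / mulI / monoBox / dmonoBox / drowBox` — outward-rounded (`roundOut prec`) Moore enclosures of
  `x^e`, products, monomials, `∂ₖ`(monomial), `∂ₖ`(row) over a box, with the inclusion property (`mem_drowBox`);
  terms not mentioning `xₖ` are skipped (`dmonoVal_eq_zero`);
* `SparseKrawczykCert n` = tables + box + center + preconditioner + supplied interval Jacobian; `toData` = the same
  certificate in the parent format; `rowOKp i` = THE SPARSE PER-ROW OBLIGATION (`∂ₖ`-row enclosure ⊆ `jac i k` for all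
  `k`, value at the centre answers); `sound` / `existsUnique_zero` / `zero_mem_krawczykBox`: all `rowOKp` + the parent's
  `coreCheck` ⇒ exactly one zero in the box (Neumaier Thm 5.1.8 via `KrawczykTest_holds`);
* kernel example: Moore's system (5.11) in table form (`mooreSparse`, `decide +kernel`).

Sources: R. E. Moore, *Methods and Applications of Interval Analysis* (SIAM 1979) §2.2, §3.3 Cor. 3.1, §4.3 (4.21), §5.2
Thms 5.3–5.4 [Moore1979]; A. Neumaier, *Interval Methods for Systems of Equations* (CUP 1990) Thm 5.1.8, Cor. 5.1.5
[Neumaier1991].  Generic; no NS content.  AI-produced formalisation (H21, seat ns-k2-port-2 g2, 2026-08-28).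
-/

set_option autoImplicit false

noncomputable section

open Set NonemptyInterval Matrix
open Literature.Analysis.ODE Literature.Analysis.ODE.FExpr
open Literature.Analysis.ValidatedNumerics.ITaylor

namespace Literature.Analysis.ValidatedNumerics

namespace SparsePoly

variable {n : ℕ} [NeZero n]

/-! ### Tables and their code lists -/

/-- Variable index of a table entry (reduced mod `n`, so that any `ℕ` is accepted). [cite: Moore1979, §3.4 (code lists)] -/
def idx (v : ℕ) : Fin n := ⟨v % n, Nat.mod_lt _ (Nat.pos_of_ne_zero (NeZero.ne n))⟩

/-- A rational coefficient `p/q` given as `(p, q)`. [cite: Moore1979, §3.4 (code lists)] -/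
def qOf (c : ℤ × ℕ) : ℚ := (c.1 : ℚ) / (c.2 : ℚ)

/-- The code list of the monomial `x_{v₁}^{e₁} ⋯ x_{v_r}^{e_r}`. [cite: Moore1979, §3.4 (code lists)] -/
def monoE : List (ℕ × ℕ) → FExpr n
  | [] => .const 1
  | (v, e) :: t => .mul (.pow (.var (idx v)) e) (monoE t)

/-- The code list of a table `∑ c · monomial`. [cite: Moore1979, §3.4 (code lists)] -/
def ofTerms : List ((ℤ × ℕ) × List (ℕ × ℕ)) → FExpr n
  | [] => .const 0
  | (c, m) :: t => .add (.smul (qOf c) (monoE m)) (ofTerms t)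

/-- Value of a monomial. [cite: Moore1979, §3.3 Cor. 3.1] -/
def monoVal (x : Fin n → ℝ) : List (ℕ × ℕ) → ℝ
  | [] => 1
  | (v, e) :: t => x (idx v) ^ e * monoVal x t

/-- Value of a table. [cite: Moore1979, §3.3 Cor. 3.1] -/
def rowVal (x : Fin n → ℝ) : List ((ℤ × ℕ) × List (ℕ × ℕ)) → ℝ
  | [] => 0
  | (c, m) :: t => (qOf c : ℝ) * monoVal x m + rowVal x t

/-- `k`-th partial of a monomial, in the product-rule form produced by `FExpr.pderiv`. [cite: Moore1979, §4.3 eq. (4.21)] -/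
def dmonoVal (k : Fin n) (x : Fin n → ℝ) : List (ℕ × ℕ) → ℝ
  | [] => 0
  | (v, e) :: t => ((e : ℚ) : ℝ) * (x (idx v) ^ (e - 1) * ((if idx v = k then (1 : ℚ) else 0 : ℚ) : ℝ)) * monoVal x t
      + x (idx v) ^ e * dmonoVal k x t

/-- `k`-th partial of a table. [cite: Moore1979, §4.3 eq. (4.21)] -/
def drowVal (k : Fin n) (x : Fin n → ℝ) : List ((ℤ × ℕ) × List (ℕ × ℕ)) → ℝ
  | [] => 0
  | (c, m) :: t => (qOf c : ℝ) * dmonoVal k x m + drowVal k x t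

/-- [cite: Moore1979, §3.3 Cor. 3.1] -/
theorem eval_monoE (x : Fin n → ℝ) : ∀ m : List (ℕ × ℕ), (monoE m : FExpr n).eval x = monoVal x m
  | [] => by simp [monoE, monoVal, FExpr.eval]
  | (v, e) :: t => by simp [monoE, monoVal, FExpr.eval, eval_monoE x t]

/-- [cite: Moore1979, §3.3 Cor. 3.1] -/
theorem eval_ofTerms (x : Fin n → ℝ) :
    ∀ T : List ((ℤ × ℕ) × List (ℕ × ℕ)), (ofTerms T : FExpr n).eval x = rowVal x T
  | [] => by simp [ofTerms, rowVal, FExpr.eval]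
  | (c, m) :: t => by simp [ofTerms, rowVal, FExpr.eval, eval_monoE, eval_ofTerms x t]

/-- Monomials are defined everywhere. [cite: Moore1979, §3.4 (last paragraph)] -/
theorem dom_monoE (x : Fin n → ℝ) : ∀ m : List (ℕ × ℕ), (monoE m : FExpr n).dom x
  | [] => by simp [monoE, FExpr.dom]
  | (v, e) :: t => by
      simp only [monoE, FExpr.dom]
      exact ⟨trivial, dom_monoE x t⟩

/-- Tables are defined everywhere. [cite: Moore1979, §3.4 (last paragraph)] -/
theorem dom_ofTerms (x : Fin n → ℝ) : ∀ T : List ((ℤ × ℕ) × List (ℕ × ℕ)), (ofTerms T : FExpr n).dom x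
  | [] => by simp [ofTerms, FExpr.dom]
  | (c, m) :: t => by
      simp only [ofTerms, FExpr.dom]
      exact ⟨dom_monoE x m, dom_ofTerms x t⟩

/-- The derived code list of a monomial evaluates to `dmonoVal`. [cite: Moore1979, §4.3 eq. (4.21)] -/
theorem eval_pderiv_monoE (k : Fin n) (x : Fin n → ℝ) :
    ∀ m : List (ℕ × ℕ), ((monoE m : FExpr n).pderiv k).eval x = dmonoVal k x m
  | [] => by simp [monoE, dmonoVal, FExpr.pderiv, FExpr.eval]
  | (v, e) :: t => by
      simp only [monoE, dmonoVal, FExpr.pderiv, FExpr.eval, eval_monoE x t, eval_pderiv_monoE k x t]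

/-- The derived code list of a table evaluates to `drowVal`. [cite: Moore1979, §4.3 eq. (4.21)] -/
theorem eval_pderiv_ofTerms (k : Fin n) (x : Fin n → ℝ) :
    ∀ T : List ((ℤ × ℕ) × List (ℕ × ℕ)), ((ofTerms T : FExpr n).pderiv k).eval x = drowVal k x T
  | [] => by simp [ofTerms, drowVal, FExpr.pderiv, FExpr.eval]
  | (c, m) :: t => by
      simp only [ofTerms, drowVal, FExpr.pderiv, FExpr.eval, eval_pderiv_monoE, eval_pderiv_ofTerms k x t]

/-- Does the monomial mention `x_k`? [cite: Moore1979, §4.3 eq. (4.21)] -/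
def mentionsM (k : Fin n) (m : List (ℕ × ℕ)) : Bool := m.any fun ve => decide (idx ve.1 = k)

/-- A monomial not mentioning `x_k` has `∂ₖ = 0`. [cite: Moore1979, §4.3 eq. (4.21)] -/
theorem dmonoVal_eq_zero (k : Fin n) (x : Fin n → ℝ) :
    ∀ m : List (ℕ × ℕ), mentionsM k m = false → dmonoVal k x m = 0
  | [], _ => by simp [dmonoVal]
  | (v, e) :: t, h => by
      simp only [mentionsM, List.any_cons, Bool.or_eq_false_iff, decide_eq_false_iff_not] at h
      simp [dmonoVal, h.1, dmonoVal_eq_zero k x t h.2]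

/-! ### Rounded Moore enclosures from the table -/

/-- `x ∈ I ⇒ x^e ∈ powI`: Moore power, rounded outward to `prec` bits. [cite: Moore1979, §2.2] -/
def powI (prec : ℕ) (I : Iv) (e : ℕ) : Iv := (I.moorePow e).roundOut prec

/-- Rounded Moore product. [cite: Moore1979, §2.2] -/
def mulI (prec : ℕ) (I J : Iv) : Iv := (I.mooreMul J).roundOut prec

/-- [cite: Moore1979, §2.2] -/
theorem mem_powI (prec : ℕ) {I : Iv} {a : ℝ} (ha : a ∈ I.ratCast ℝ) (e : ℕ) :
    a ^ e ∈ (powI prec I e).ratCast ℝ := by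
  unfold powI
  apply mem_roundOut
  rw [ratCast_moorePow]
  exact pow_mem_moorePow ha e

/-- [cite: Moore1979, §2.2] -/
theorem mem_mulI (prec : ℕ) {I J : Iv} {a b : ℝ} (ha : a ∈ I.ratCast ℝ) (hb : b ∈ J.ratCast ℝ) :
    a * b ∈ (mulI prec I J).ratCast ℝ := by
  unfold mulI
  apply mem_roundOut
  rw [ratCast_mooreMul]
  exact mul_mem_mooreMul ha hb

/-- A rational point lies in its degenerate interval. [cite: Moore1979, §2.2 (degenerate intervals)] -/
theorem mem_pure_ratCast (q : ℚ) : (q : ℝ) ∈ (pure q : Iv).ratCast ℝ := by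
  rw [ratCast_pure]
  exact mem_pure_self _

/-- Enclosure of a monomial over a box (natural extension in monomial form). [cite: Moore1979, §3.3 Cor. 3.1] -/
def monoBox (prec : ℕ) (X : Fin n → Iv) : List (ℕ × ℕ) → Iv
  | [] => pure 1
  | (v, e) :: t => mulI prec (powI prec (X (idx v)) e) (monoBox prec X t)

/-- Enclosure of `∂ₖ`(monomial) over a box, term by term as in `dmonoVal`; branches that are identically `0` are
skipped. [cite: Moore1979, §4.3 eq. (4.21)] -/
def dmonoBox (prec : ℕ) (k : Fin n) (X : Fin n → Iv) : List (ℕ × ℕ) → Iv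
  | [] => pure 0
  | (v, e) :: t =>
      (if idx v = k then mulI prec (mulI prec (pure (e : ℚ)) (powI prec (X (idx v)) (e - 1))) (monoBox prec X t)
        else pure 0)
      + (if mentionsM k t then mulI prec (powI prec (X (idx v)) e) (dmonoBox prec k X t) else pure 0)

/-- Enclosure of `∂ₖ`(row) over a box; terms not mentioning `x_k` cost nothing. [cite: Moore1979, §4.3 eq. (4.21)] -/
def drowBox (prec : ℕ) (k : Fin n) (X : Fin n → Iv) : List ((ℤ × ℕ) × List (ℕ × ℕ)) → Iv
  | [] => pure 0
  | (c, m) :: t =>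
      if mentionsM k m then mulI prec (pure (qOf c)) (dmonoBox prec k X m) + drowBox prec k X t
      else drowBox prec k X t

variable (prec : ℕ) {X : Fin n → Iv} {y : Fin n → ℝ}

/-- Inclusion property of `monoBox`. [cite: Moore1979, §3.3 Cor. 3.1] -/
theorem mem_monoBox (hy : ∀ j, y j ∈ (X j).ratCast ℝ) :
    ∀ m : List (ℕ × ℕ), monoVal y m ∈ (monoBox prec X m).ratCast ℝ
  | [] => by
      simp only [monoVal, monoBox]
      exact_mod_cast mem_pure_ratCast (1 : ℚ)
  | (v, e) :: t => by
      simp only [monoVal, monoBox]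
      exact mem_mulI prec (mem_powI prec (hy _) e) (mem_monoBox hy t)

/-- Inclusion property of `dmonoBox`. [cite: Moore1979, §4.3 eq. (4.21)] -/
theorem mem_dmonoBox (hy : ∀ j, y j ∈ (X j).ratCast ℝ) (k : Fin n) :
    ∀ m : List (ℕ × ℕ), dmonoVal k y m ∈ (dmonoBox prec k X m).ratCast ℝ
  | [] => by
      simp only [dmonoVal, dmonoBox]
      exact_mod_cast mem_pure_ratCast (0 : ℚ)
  | (v, e) :: t => by
      simp only [dmonoVal, dmonoBox, QMvPoly.ratCast_add]
      refine add_mem_add' ?_ ?_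
      · split_ifs with h
        · simp only [Rat.cast_one, mul_one]
          exact mem_mulI prec (mem_mulI prec (mem_pure_ratCast (e : ℚ)) (mem_powI prec (hy _) (e - 1)))
            (mem_monoBox prec hy t)
        · simp only [Rat.cast_zero, mul_zero, zero_mul]
          exact_mod_cast mem_pure_ratCast (0 : ℚ)
      · split_ifs with h
        · exact mem_mulI prec (mem_powI prec (hy _) e) (mem_dmonoBox hy k t)
        · rw [dmonoVal_eq_zero k y t (by simpa using h), mul_zero]
          exact_mod_cast mem_pure_ratCast (0 : ℚ)

/-- **Inclusion property of the sparse `∂ₖ`-row enclosure.** [cite: Moore1979, §4.3 eq. (4.21)] [cite: Moore1979, §3.3 Cor. 3.1] -/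
theorem mem_drowBox (hy : ∀ j, y j ∈ (X j).ratCast ℝ) (k : Fin n) :
    ∀ T : List ((ℤ × ℕ) × List (ℕ × ℕ)), drowVal k y T ∈ (drowBox prec k X T).ratCast ℝ
  | [] => by
      simp only [drowVal, drowBox]
      exact_mod_cast mem_pure_ratCast (0 : ℚ)
  | (c, m) :: t => by
      simp only [drowVal, drowBox]
      split_ifs with h
      · rw [QMvPoly.ratCast_add]
        exact add_mem_add' (mem_mulI prec (mem_pure_ratCast (qOf c)) (mem_dmonoBox prec hy k m))
          (mem_drowBox hy k t)
      · rw [dmonoVal_eq_zero k y m (by simpa using h), mul_zero, zero_add]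
        exact mem_drowBox hy k t

end SparsePoly

/-! ### The certificate -/

/-- A Krawczyk certificate whose system is given by monomial TABLES (format (C)); `jac` is the SUPPLIED interval
Jacobian, `prec` the bit precision of the outward rounding in the row enclosures. [cite: Neumaier1991, Thm 5.1.8]
[cite: Moore1979, §5.2 Thm 5.4] -/
structure SparseKrawczykCert (n : ℕ) [NeZero n] where
  /-- The system: one table per component. -/
  table : Fin n → List ((ℤ × ℕ) × List (ℕ × ℕ))
  /-- The box `X`. -/
  box : Fin n → Iv
  /-- The point `x̃ ∈ int X`. -/
  center : Fin n → ℚ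
  /-- The point preconditioning matrix `C ≈ (mid F'(X))⁻¹`. -/
  precond : Matrix (Fin n) (Fin n) ℚ
  /-- Precision parameters of the code-list runs (value at the centre). -/
  cfg : SeedCfg
  /-- Bit precision of the outward rounding in the sparse row enclosures. -/
  prec : ℕ
  /-- The SUPPLIED interval Jacobian `[J]`. -/
  jac : Fin n → Fin n → Iv

/-- The cast of the negated preconditioner. [folklore] -/
private theorem castQMat_neg_sparse {n : ℕ} (C : Matrix (Fin n) (Fin n) ℚ) : castQMat (-C) = -castQMat C := by
  ext i l
  simp only [castQMat_apply, Matrix.neg_apply, Rat.cast_neg]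

namespace SparseKrawczykCert

variable {n : ℕ} [NeZero n] (c : SparseKrawczykCert n)

/-- The same certificate in the parent (code-list) format. [cite: Neumaier1991, Thm 5.1.8] -/
def toData : CodeListKrawczykDataCert n where
  system := fun i => SparsePoly.ofTerms (c.table i)
  box := c.box
  center := c.center
  precond := c.precond
  cfg := c.cfg
  jac := c.jac

/-- Entry `(i,k)`: the sparse `∂ₖ`-row enclosure lies inside the supplied `jac i k`. [cite: Moore1979, §4.3 eq. (4.21)] -/
def jacOKp (i k : Fin n) : Bool :=
  let D := SparsePoly.drowBox c.prec k c.box (c.table i)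
  decide ((c.jac i k).fst ≤ D.fst) && decide (D.snd ≤ (c.jac i k).snd)

/-- **THE SPARSE PER-ROW OBLIGATION** (format (C)): the value of row `i` at the centre answers and every entry of the
supplied Jacobian row contains the sparse enclosure. [cite: Moore1979, §4.3 eq. (4.21)] [cite: Neumaier1991, Cor. 5.1.5] -/
def rowOKp (i : Fin n) : Bool :=
  (c.toData.valOpt i).isSome && (List.finRange n).all fun k => c.jacOKp i k

/-- Every point lies in the natural domain of a table system. [cite: Moore1979, §3.4 (last paragraph)] -/
theorem mem_dom (y : Fin n → ℝ) : y ∈ (domOpens c.toData.system : Set (Fin n → ℝ)) := by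
  rw [SetLike.mem_coe, mem_domOpens]
  intro i
  exact SparsePoly.dom_ofTerms y (c.table i)

/-- Unpacking a certified row. [cite: Moore1979, §4.3 eq. (4.21)] -/
theorem rowOKp_spec {i : Fin n} (h : c.rowOKp i = true) (k : Fin n) :
    c.toData.valOpt i = some (c.toData.valBox i) ∧ c.jacOKp i k = true := by
  simp only [rowOKp, Bool.and_eq_true] at h
  obtain ⟨h1, h3⟩ := h
  refine ⟨?_, List.all_eq_true.1 h3 k (List.mem_finRange k)⟩
  cases hv : c.toData.valOpt i with
  | none => rw [hv] at h1; exact absurd h1 (by simp)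
  | some I => simp [CodeListKrawczykDataCert.valBox, hv]

/-- `f(x̃) ∈ F([x̃, x̃])`. [cite: Moore1979, §5.2 eq. (5.6) (the term f(y))] -/
theorem value_mem_valBox (hr : ∀ i, c.rowOKp i = true) (i : Fin n) :
    fieldFun c.toData.system (fun l => (c.center l : ℝ)) i ∈ (c.toData.valBox i).ratCast ℝ :=
  (evalBox_sound (c.rowOKp_spec (hr i) i).1 (ratVec_mem_pointBox c.center)).2

/-- **The supplied interval Jacobian encloses the Jacobian** on `X` (sparse enclosure ⊆ supplied entry).
[cite: Moore1979, §4.3 eq. (4.21)] [cite: Neumaier1991, Prop. 5.1.4] -/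
theorem fderiv_apply_mem_jac (hr : ∀ i, c.rowOKp i = true) {y : Fin n → ℝ}
    (hy : y ∈ boxSet (castBox c.box)) (i k : Fin n) :
    fderiv ℝ (fieldFun c.toData.system) y (Pi.single k 1) i ∈ castMat c.jac i k := by
  have hk := (c.rowOKp_spec (hr i) k).2
  simp only [jacOKp, Bool.and_eq_true, decide_eq_true_eq] at hk
  have hy' : ∀ j, y j ∈ (c.box j).ratCast ℝ := fun j => by
    have h := (mem_boxSet_iff.1 hy) j
    rwa [castBox_apply] at h
  have hm := SparsePoly.mem_drowBox c.prec hy' k (c.table i)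
  rw [mem_ratCast_iff] at hm
  rw [castMat_apply, fderiv_fieldFun_apply_single c.toData.system (c.mem_dom y) i k, mem_ratCast_iff,
    show c.toData.system i = SparsePoly.ofTerms (c.table i) from rfl, SparsePoly.eval_pderiv_ofTerms]
  exact ⟨le_trans (by exact_mod_cast hk.1) hm.1, le_trans hm.2 (by exact_mod_cast hk.2)⟩

/-- The system is differentiable everywhere on the box. [cite: Moore1979, §3.4 (last paragraph)] -/
theorem hasFDerivAt_fieldFun (y : Fin n → ℝ) :
    HasFDerivAt (fieldFun c.toData.system) (fderiv ℝ (fieldFun c.toData.system) y) y :=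
  ((((contDiffOn_fieldFun c.toData.system).differentiableOn (by simp)) y (c.mem_dom y)).differentiableAt
    ((domOpens c.toData.system).isOpen.mem_nhds (c.mem_dom y))).hasFDerivAt

/-- **The supplied interval Jacobian is a Lipschitz matrix for `f` on `X`.** [cite: Neumaier1991, Cor. 5.1.5] -/
theorem isLipschitzSetOn_lipMat (hr : ∀ i, c.rowOKp i = true) :
    IsLipschitzSetOn c.toData.lipMat (fieldFun c.toData.system) (boxSet (castBox c.box)) :=
  isLipschitzSetOn_matrixIcc_of_hasFDerivWithinAt (convex_boxSet _)
    (fun y _ => (c.hasFDerivAt_fieldFun y).hasFDerivWithinAt)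
    fun y hy i k => by
      have h := c.fderiv_apply_mem_jac hr hy i k
      rw [castMat_apply, mem_ratCast_iff] at h
      exact h

/-- The computed Krawczyk box encloses the Krawczyk set. [cite: Neumaier1991, §3.1 Proposition 3.1.2 (6)]
[cite: Moore1979, §5.2 eq. (5.6)] -/
theorem kSet_subset_krawczykBox (hr : ∀ i, c.rowOKp i = true) :
    c.toData.kSet ⊆ boxSet (castBox c.toData.krawczykBox) := by
  intro z hz
  rw [mem_boxSet_iff]
  intro i
  obtain ⟨B, hB, y, hy, hzi⟩ := hz i
  have hp : (fun l => (c.center l : ℝ)) - castQMat c.precond *ᵥ fieldFun c.toData.system (fun l => (c.center l : ℝ))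
      ∈ boxSet (castBox c.toData.residualBox) := by
    rw [mem_boxSet_iff]
    intro j
    rw [sub_eq_add_neg, ← Matrix.neg_mulVec, ← castQMat_neg_sparse]
    simp only [castBox_apply, CodeListKrawczykDataCert.residualBox, QMvPoly.ratCast_add, ratCast_pure, Pi.add_apply]
    refine add_mem_add' (mem_pure_self _) ?_
    have h := mulVec_mem_imatvecQ (fun a b => castQMat_mem_pointMat (-c.precond) a b)
      (fun l => by rw [castBox_apply]; exact c.value_mem_valBox hr l) j
    rwa [castBox_apply] at h
  have hM : ∀ a b, (1 - B) a b ∈ castMat c.toData.slopeBox a b := by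
    intro a b
    obtain ⟨M, hM, hab⟩ := hB a b
    rw [Matrix.sub_apply, hab, sub_eq_add_neg, ← Matrix.neg_apply, ← Matrix.neg_mul, ← castQMat_neg_sparse,
      castMat_apply]
    simp only [CodeListKrawczykDataCert.slopeBox, QMvPoly.ratCast_add]
    refine add_mem_add' ?_ ?_
    · have h1 := castQMat_mem_pointMat (1 : Matrix (Fin n) (Fin n) ℚ) a b
      rw [castQMat_one, castMat_apply] at h1
      exact h1
    · have h2 := mul_mem_imatmulQ (fun i k => castQMat_mem_pointMat (-c.precond) i k)
        ((c.toData.mem_lipMat_iff).1 hM) a b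
      rwa [castMat_apply] at h2
  have hmv := meanValue_mem_mvBoxQ (m := c.center) hp hM hy
  have heq : (fun l => (c.center l : ℝ)) - castQMat c.precond *ᵥ fieldFun c.toData.system (fun l => (c.center l : ℝ))
        - (B - 1) *ᵥ (y - fun l => (c.center l : ℝ)) =
      (fun l => (c.center l : ℝ)) - castQMat c.precond *ᵥ fieldFun c.toData.system (fun l => (c.center l : ℝ))
        + (1 - B) *ᵥ (y - fun l => (c.center l : ℝ)) := by
    rw [sub_eq_add_neg (_ - _), ← Matrix.neg_mulVec, neg_sub]
  rw [hzi]
  have hi := (mem_boxSet_iff.1 hmv) i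
  rw [← heq] at hi
  exact hi

/-- **SOUNDNESS OF THE SPARSE (FORMAT (C)) KRAWCZYK CERTIFICATE**: all sparse row obligations + the core check ⇒ the
supplied `[J]` is regular, `f` has EXACTLY ONE zero in `X`, and every zero in `X` lies in `K(X, x̃)`.
[cite: Neumaier1991, Thm 5.1.8] [cite: Moore1979, §5.2 Thms 5.3–5.4] -/
theorem sound (hr : ∀ i, c.rowOKp i = true) (hc : c.toData.coreCheck = true) :
    (∀ M ∈ c.toData.lipMat, M.det ≠ 0) ∧
    (∃! z, z ∈ boxSet (castBox c.box) ∧ fieldFun c.toData.system z = 0) ∧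
    (∀ z ∈ boxSet (castBox c.box), fieldFun c.toData.system z = 0 → z ∈ boxSet (castBox c.toData.krawczykBox)) := by
  have h := KrawczykTest_holds n (fieldFun c.toData.system) (boxSet (castBox c.box))
    (fun i k => (((c.jac i k).fst : ℚ) : ℝ)) (fun i k => (((c.jac i k).snd : ℚ) : ℝ))
    (castQMat c.precond) (boxLo (castBox c.box)) (boxHi (castBox c.box)) (fun l => (c.center l : ℝ))
    (exists_lipschitzOnWith_of_isLipschitzSetOn (c.isLipschitzSetOn_lipMat hr))
    (c.isLipschitzSetOn_lipMat hr) (fun _ hy => hy) (c.toData.center_mem_interior hc) (c.toData.kSet_nonempty hc)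
    ((c.kSet_subset_krawczykBox hr).trans (boxSet_subset_interior_of_strictIn (c.toData.coreCheck_spec hc).2))
  exact ⟨h.1, h.2.1, fun z hz h0 => c.kSet_subset_krawczykBox hr (h.2.2 z hz h0)⟩

/-- **Exactly one solution of the table system in the box.** [cite: Moore1979, §5.2 Thm 5.4] [cite: Neumaier1991, Thm 5.1.8 (iii)] -/
theorem existsUnique_zero (hr : ∀ i, c.rowOKp i = true) (hc : c.toData.coreCheck = true) :
    ∃! z, z ∈ boxSet (castBox c.box) ∧ ∀ i, SparsePoly.rowVal z (c.table i) = 0 := by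
  have h := (c.sound hr hc).2.1
  simp only [funext_iff] at h
  simpa only [fieldFun, toData, SparsePoly.eval_ofTerms, Pi.zero_apply] using h

/-- **Every solution in the box lies in the Krawczyk box.** [cite: Moore1979, §5.2 Thm 5.3] [cite: Neumaier1991, Thm 5.1.8 (i)] -/
theorem zero_mem_krawczykBox (hr : ∀ i, c.rowOKp i = true) (hc : c.toData.coreCheck = true) {z : Fin n → ℝ}
    (hz : z ∈ boxSet (castBox c.box)) (h0 : ∀ i, SparsePoly.rowVal z (c.table i) = 0) :
    z ∈ boxSet (castBox c.toData.krawczykBox) :=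
  (c.sound hr hc).2.2 z hz (funext fun i => by
    simpa only [fieldFun, toData, SparsePoly.eval_ofTerms, Pi.zero_apply] using h0 i)

end SparseKrawczykCert

/-! ### Kernel example: Moore's system (5.11) in table form

`f₁ = x₀² + x₁² − 1`, `f₂ = x₀ − x₁²` on `X = ([.5,.8],[.6,.9])`, centre `(.65,.75)`, `C ≈ (mid F'(X))⁻¹`, the interval
Jacobian supplied with a margin `1/100`. -/

/-- Moore's (5.11) as a format-(C) certificate. [cite: Moore1979, §5.2 eqs. (5.11)–(5.13)] -/
def mooreSparse : SparseKrawczykCert 2 where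
  table := ![[(((1 : ℤ), 1), [(0, 2)]), (((1 : ℤ), 1), [(1, 2)]), (((-1 : ℤ), 1), [])],
    [(((1 : ℤ), 1), [(0, 1)]), (((-1 : ℤ), 1), [(1, 2)])]]
  box := ![⟨(5 / 10, 8 / 10), by decide +kernel⟩, ⟨(6 / 10, 9 / 10), by decide +kernel⟩]
  center := ![65 / 100, 75 / 100]
  precond := !![43 / 100, 43 / 100; 29 / 100, -37 / 100]
  cfg := ⟨40, 30, 12, 3, 0⟩
  prec := 40
  jac := fun i k => (![![(⟨(99 / 100, 161 / 100), by decide +kernel⟩ : Iv), ⟨(119 / 100, 181 / 100), by decide +kernel⟩],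
    ![(⟨(99 / 100, 101 / 100), by decide +kernel⟩ : Iv), ⟨(-181 / 100, -119 / 100), by decide +kernel⟩]] i) k

/-- Both sparse row obligations hold. [cite: Moore1979, §5.2 eqs. (5.11)–(5.13)] -/
theorem mooreSparse_rows (i : Fin 2) : mooreSparse.rowOKp i = true := by
  fin_cases i <;> decide +kernel

/-- The core check holds. [cite: Moore1979, §5.2 eq. (5.13)] -/
theorem mooreSparse_core : mooreSparse.toData.coreCheck = true := by
  decide +kernel

/-- Exactly one solution of (5.11) in the box, certified in format (C). [cite: Moore1979, §5.2 Thm 5.4] -/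
theorem mooreSparse_existsUnique :
    ∃! z, z ∈ boxSet (castBox mooreSparse.box) ∧ ∀ i, SparsePoly.rowVal z (mooreSparse.table i) = 0 :=
  mooreSparse.existsUnique_zero mooreSparse_rows mooreSparse_core

/-! ### Text encoding of tables (bulk data without literal elaboration)

A table with 10⁴–10⁵ terms written as nested list/tuple literals costs ≈ 30 s of elaboration per 1 800 terms (the list
notation elaborates recursively and must be sliced into small `def`s); as ONE string literal it costs nothing measurable.
The text format is the flattest possible rendering of the code list (Moore's "sequence of arithmetic statements", §3.4):
whitespace-separated decimal integers, each term as `p q r v₁ e₁ … v_r e_r` (`p/q` the coefficient, `r` the number of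
factors).  The decoder is total: malformed input yields SOME table, and every theorem above is about the decoded table,
so soundness is untouched; the producer re-parses its own output to confirm the intended system. -/

namespace SparsePoly

/-- The whitespace-separated decimal integers of a string (an optional `-` immediately before the digits).
[cite: Moore1979, §3.4 (code lists)] -/
def parseInts (s : String) : List ℤ :=
  let st := s.foldl (fun (st : List ℤ × ℕ × Bool × Bool) ch =>
    let (acc, cur, ng, inNum) := st
    if ch.isDigit then (acc, cur * 10 + (ch.toNat - 48), ng, true)
    else if ch = '-' then (acc, cur, true, inNum)
    else if inNum then ((if ng then -(cur : ℤ) else (cur : ℤ)) :: acc, 0, false, false)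
    else (acc, 0, false, false)) ([], 0, false, false)
  let (acc, cur, ng, inNum) := st
  (if inNum then (if ng then -(cur : ℤ) else (cur : ℤ)) :: acc else acc).reverse

/-- Read `r` factors `v e` off an integer stream. [cite: Moore1979, §3.4 (code lists)] -/
def takeFactors : ℕ → List ℤ → List (ℕ × ℕ) × List ℤ
  | 0, l => ([], l)
  | r + 1, v :: e :: l =>
      let p := takeFactors r l
      ((v.toNat, e.toNat) :: p.1, p.2)
  | _ + 1, l => ([], l)

/-- Decode an integer stream `p q r v₁ e₁ … v_r e_r …` into a table (`fuel` bounds the number of terms).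
[cite: Moore1979, §3.4 (code lists)] -/
def decodeStream : ℕ → List ℤ → List ((ℤ × ℕ) × List (ℕ × ℕ))
  | 0, _ => []
  | _ + 1, [] => []
  | fuel + 1, c :: d :: r :: l =>
      let p := takeFactors r.toNat l
      ((c, d.toNat), p.1) :: decodeStream fuel p.2
  | _ + 1, _ => []

/-- **The table denoted by a text**: `decodeTable "1 1 1 0 2  1 1 1 1 2  -1 1 0"` is `x₀² + x₁² − 1`.
[cite: Moore1979, §3.4 (code lists)] -/
def decodeTable (s : String) : List ((ℤ × ℕ) × List (ℕ × ℕ)) :=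
  let l := parseInts s
  decodeStream l.length l

end SparsePoly

-- Executable documentation (compiled evaluation at elaboration time; `String` operations do not reduce in the kernel,
-- so text-encoded certificates are checked by `native_decide`, like every bulk certificate):
#guard SparsePoly.decodeTable "1 1 1 0 2  1 1 1 1 2  -1 1 0" ==
  [(((1 : ℤ), 1), [(0, 2)]), (((1 : ℤ), 1), [(1, 2)]), (((-1 : ℤ), 1), ([] : List (ℕ × ℕ)))]
#guard (SparsePoly.decodeTable "1 1 1 0 2  1 1 1 1 2  -1 1 0" == mooreSparse.table 0)
#guard (SparsePoly.decodeTable "1 1 1 0 1\n-1 1 1 1 2" == mooreSparse.table 1)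

/-! ### The row obligation with the table decoded ONCE

`rowOKp i` mentions `c.table i` inside the loop over `k`; when `table i` is COMPUTED (e.g. `decodeTable` of a large
string) that re-decodes the row `n` times (measured: 185 × 0.23 s for a 7 829-term row).  `rowOKq` hoists it; the two
are definitionally equal. -/

namespace SparseKrawczykCert

variable {n : ℕ} [NeZero n] (c : SparseKrawczykCert n)

/-- Entry check on an already-decoded table. [cite: Moore1979, §4.3 eq. (4.21)] -/
def jacOKt (T : List ((ℤ × ℕ) × List (ℕ × ℕ))) (i k : Fin n) : Bool :=
  let D := SparsePoly.drowBox c.prec k c.box T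
  decide ((c.jac i k).fst ≤ D.fst) && decide (D.snd ≤ (c.jac i k).snd)

/-- **The sparse per-row obligation, table decoded once** (use this one in certificates). [cite: Moore1979, §4.3 eq. (4.21)]
[cite: Neumaier1991, Cor. 5.1.5] -/
def rowOKq (i : Fin n) : Bool :=
  let T := c.table i
  (c.toData.valOpt i).isSome && (List.finRange n).all fun k => c.jacOKt T i k

/-- `rowOKq` is `rowOKp`. [cite: Moore1979, §4.3 eq. (4.21)] -/
theorem rowOKq_eq (i : Fin n) : c.rowOKq i = c.rowOKp i := rfl

/-- All `rowOKq` ⇒ all `rowOKp` (the hypothesis of `sound` / `existsUnique_zero`). [cite: Neumaier1991, Thm 5.1.8] -/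
theorem rowOKp_of_rowOKq (h : ∀ i, c.rowOKq i = true) (i : Fin n) : c.rowOKp i = true :=
  (c.rowOKq_eq i) ▸ h i

end SparseKrawczykCert

/-- Moore's rows pass the hoisted obligation too (same computation). [cite: Moore1979, §5.2 eqs. (5.11)–(5.13)] -/
theorem mooreSparse_rowsq (i : Fin 2) : mooreSparse.rowOKq i = true := by
  fin_cases i <;> decide +kernel

/-! ### Text encoding of the remaining bulk data (centre, preconditioner, supplied Jacobian)

Same device as `decodeTable` for the other arrays of a large certificate: rationals as integer pairs `p q`, a sparse
Jacobian row as triples `k  p₁ q₁  p₂ q₂` (entry `k`, lower and upper end), missing entries meaning the point interval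
`[0, 0]`.  Total decoders; every theorem is about the decoded data. -/

namespace SparsePoly

/-- Consecutive integer pairs `p q` as rationals `p/q`. [cite: Moore1979, §3.4 (code lists)] -/
def ratsOfInts : List ℤ → List ℚ
  | p :: q :: l => qOf (p, q.toNat) :: ratsOfInts l
  | _ => []

/-- **Rationals from text** (`"1 3  -5 2"` ↦ `[1/3, -5/2]`). [cite: Moore1979, §3.4 (code lists)] -/
def decodeRats (s : String) : List ℚ := ratsOfInts (parseInts s)

/-- The interval `[lo, hi]` if `lo ≤ hi`, else the point `[lo, lo]`. [cite: Moore1979, §2.2 (degenerate intervals)] -/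
def ivOf (lo hi : ℚ) : Iv := if h : lo ≤ hi then ⟨(lo, hi), h⟩ else pure lo

/-- Integer stream `k p₁ q₁ p₂ q₂ …` as a sparse interval row. [cite: Moore1979, §2.2] -/
def idxIvsOfInts : List ℤ → List (ℕ × Iv)
  | k :: p₁ :: q₁ :: p₂ :: q₂ :: l => (k.toNat, ivOf (qOf (p₁, q₁.toNat)) (qOf (p₂, q₂.toNat))) :: idxIvsOfInts l
  | _ => []

/-- **A sparse interval row from text.** [cite: Moore1979, §2.2] -/
def decodeIdxIvs (s : String) : List (ℕ × Iv) := idxIvsOfInts (parseInts s)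

/-- Entry `k` of a sparse interval row (point interval `[0, 0]` if absent). [cite: Moore1979, §2.2 (degenerate intervals)] -/
def ivAt (row : List (ℕ × Iv)) (k : ℕ) : Iv :=
  match row.find? (fun t => t.1 == k) with
  | some t => t.2
  | none => pure 0

end SparsePoly

#guard SparsePoly.decodeRats "1 3  -5 2\n7 1" == [(1 : ℚ) / 3, -5 / 2, 7]
#guard (SparsePoly.ivAt (SparsePoly.decodeIdxIvs "4 99 100 161 100  7 -3 2 -1 1") 7 == SparsePoly.ivOf (-3 / 2) (-1))
#guard (SparsePoly.ivAt (SparsePoly.decodeIdxIvs "4 99 100 161 100") 5 == (pure 0 : NonemptyInterval ℚ))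

end Literature.Analysis.ValidatedNumerics

end
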